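import Literature.NumberTheory.Automorphic.UnitaryGroupBorelHeightContinuous
import Literature.NumberTheory.Automorphic.UnitaryGroupBorelSemidirect
import Mathlib.Analysis.SpecialFunctions.Pow.Real
import Mathlib.MeasureTheory.Group.Measure
import HarnessLib

/-!
# The ray integral of the cusp estimate: a negative power of the Borel height is integrable over
# «compact · ray» in the adelic torus (Arthur's `∫_{H(a) > T} e^{-λ(H(a))} da < ∞`)

(Arthur, *A trace formula for reductive groups I*, Duke Math. J. 45 (1978), §8 pp. 947–950; Gelbart–Jacquet,
*Forms of GL(2) from the analytic point of view*, PSPM 33.1 (1979), §7 (B) (`∫_{c}^∞ t^{-s} d^×t < ∞`); Godement,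
*Domaines fondamentaux des groupes arithmétiques*, Sém. Bourbaki 257 (1962∕63), §1, §5 (Siegel sets `ω A_t K`).)

Topic `NumberTheory/Automorphic`; namespace `Literature.NumberTheory.Automorphic` (§1) and `….UnitaryGroup` (§2).
THEOREMS ONLY (no definition, no named fact, no instance, no notation, no `sorry`).  Row H10b «RAY INTEGRAL» of the
T1-qs skeleton cut of the law `TruncatedKernelIntegrable` (F0P3a-p05 census `CENSUS-T1qs-TruncatedKernelIntegrable` v3,
cell `pub/hodgecm-mathlib`, crux H413 = `stmt-HodgeConjecture-24833`): the `hΦ`-half of the Siegel majorant of ★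
`truncatedKernelIntegrable_of_majorant_maximalCompact` (`UnitaryGroupCuspIntegralSiegelMajorant`) is, after ★ H10a
(thin-set integration, `δ_B` cancels), the finiteness of `∫_{S_T′ ∩ {H > T}} H(t)^{-α} dμ_T(t)` over the torus Siegel set
`S_T′` of ★ H9a.  HC_CM is proved only modulo the printed citations until rung 0 closes.

HYPOTHESES-FIRST SHAPE (decoupled from the construction of `S_T′`).  The only structure of the torus Siegel set used is
«`S_T′ ⊆ ρ(ℝ) · 𝔎`» for a compact `𝔎 ⊆ T(𝔸)` and a one-parameter ray `ρ : ℝ → T(𝔸)` (`ρ(a + b) = ρ(a) ρ(b)`) along which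
the height is HOMOGENEOUS, `H(ρ(s) t) = e^{κ s} H(t)` with `κ > 0` (for Rogawski's `U(3)` and the diagonal ray
`ρ(s) = d(r_s, 1, r_s⁻¹)`, `r_s` the positive real idele `e^s`, this is ★ `UnitaryGroup.borelHeight_torus_mul'` with
`κ = [E : ℚ]`).  Then — §1, for ANY locally compact group, left-invariant measure and continuous `H > 0` — every negative
power `H^{-α}`, `α > 0`, is integrable over `S ∩ {H > T₀}` (`T₀ > 0`): cover by the unit shells `ρ([s₀+n, s₀+n+1]) · 𝔎`,
which are LEFT TRANSLATES of the one compact block `ρ([0,1]) · 𝔎` (same finite Haar mass `V`), bound `H^{-α}` on the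
`n`-th shell by `(m e^{κ s₀})^{-α} e^{-ακn}` (`m = min_𝔎 H > 0`), and sum the geometric series.  No modulus, no polar
decomposition of the idele group and no normalisation of the exponent are needed (H8c uses `α = 1∕(2d)`).

* §1 **`setLIntegral_rpow_neg_lt_top_of_subset_range_mul`** — the generic ray lemma.
* §2 **`UnitaryGroup.setLIntegral_rpow_neg_borelHeight_lt_top`** — the row at the adelic torus `T(𝔸_F) ≤ B(𝔸_F)` of
  `U(J_N)` (`UnitaryGroup.torusInBorel`, any `N ≥ 1`), `H := borelHeight`: continuity (★ `continuous_borelHeight`) and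
  positivity (★ `vecHeight_lastRow_pos`) discharged; inputs = the compact `𝔎`, the ray `ρ` with its height law `hH`, and
  `S ⊆ Set.range ρ * 𝔎` (the ONE clause H9a exports); `…_lt_top'` the same with the cut-off read in `ℝ≥0` as in ★ H8b.

## References
* J. Arthur, *A trace formula for reductive groups I*, Duke Math. J. 45 (1978), §8 [Arthur1978TraceFormulaI].
* S. Gelbart, H. Jacquet, *Forms of GL(2) from the analytic point of view*, PSPM 33.1 (1979), §7 [GelbartJacquet1979Corvallis].
* R. Godement, *Domaines fondamentaux des groupes arithmétiques*, Sém. Bourbaki 257 (1962∕63) [Godement1964].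
* J. R. Getz, H. Hahn, *An Introduction to Automorphic Representations*, GTM 300 (2024), §2.7, Prop. 3.2.1 [GetzHahn2024].
-/

set_option autoImplicit false

noncomputable section

open MeasureTheory Measure Set
open scoped NNReal ENNReal Pointwise

namespace Literature.NumberTheory.Automorphic

/-! ## §1 The generic ray lemma -/

section Generic

variable {G : Type*} [Group G] [TopologicalSpace G] [IsTopologicalGroup G] [T2Space G]
  [MeasurableSpace G] [BorelSpace G]

/-- **A NEGATIVE POWER OF A RAY-HOMOGENEOUS HEIGHT IS INTEGRABLE OVER «compact · ray» HIGH IN THE CUSP.**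
Let `μ` be a left-invariant measure finite on compacts on the Hausdorff topological group `G`, `𝔎 ⊆ G` compact,
`ρ : ℝ → G` a continuous one-parameter family with `ρ(a + b) = ρ(a) ρ(b)`, and `H : G → ℝ` continuous, positive on `𝔎`
and homogeneous along the ray: `H(ρ(s) g) = e^{κ s} H(g)` with `κ > 0`.  Then for every `S ⊆ ρ(ℝ) · 𝔎`, `T₀ > 0` and
`α > 0`, `∫⁻_{S ∩ {T₀ < H}} H^{-α} dμ < ∞` (Arthur's convergence of `∫_{H > T}` of a decaying exponential of the height
over a Siegel set, in the rank-one form `∫_{c}^∞ t^{-α} d^×t < ∞`: unit shells along the ray are left translates of ONE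
compact block, so have equal finite mass, and the integrand decays geometrically in the shell index).
[cite: Arthur1978TraceFormulaI, §8 (pp. 947–950)] [cite: GelbartJacquet1979Corvallis, §7 (B)] -/
theorem setLIntegral_rpow_neg_lt_top_of_subset_range_mul (μ : Measure G) [μ.IsMulLeftInvariant]
    [IsFiniteMeasureOnCompacts μ] {𝔎 : Set G} (h𝔎 : IsCompact 𝔎) {ρ : ℝ → G} (hρc : Continuous ρ)
    (hρ : ∀ a b, ρ (a + b) = ρ a * ρ b) {H : G → ℝ} (hHc : Continuous H) (hHpos : ∀ k ∈ 𝔎, 0 < H k) {κ : ℝ}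
    (hκ : 0 < κ) (hH : ∀ s g, H (ρ s * g) = Real.exp (κ * s) * H g) {S : Set G} (hS : S ⊆ Set.range ρ * 𝔎)
    {T₀ : ℝ} (hT₀ : 0 < T₀) {α : ℝ} (hα : 0 < α) :
    ∫⁻ g in S ∩ {g | T₀ < H g}, ENNReal.ofReal (H g ^ (-α)) ∂μ < ∞ := by
  classical
  rcases 𝔎.eq_empty_or_nonempty with h0 | hne
  · have hS0 : S = ∅ := Set.subset_empty_iff.1 (by simpa [h0] using hS)
    simp [hS0]
  -- extreme values of `H` on the compact `𝔎`
  obtain ⟨k₀, hk₀, hmin'⟩ := h𝔎.exists_isMinOn hne hHc.continuousOn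
  obtain ⟨k₁, hk₁, hmax'⟩ := h𝔎.exists_isMaxOn hne hHc.continuousOn
  have hmin : ∀ k ∈ 𝔎, H k₀ ≤ H k := fun k hk => (isMinOn_iff.1 hmin') k hk
  have hmax : ∀ k ∈ 𝔎, H k ≤ H k₁ := fun k hk => (isMaxOn_iff.1 hmax') k hk
  have hm0 : 0 < H k₀ := hHpos k₀ hk₀
  have hM0 : 0 < H k₁ := hHpos k₁ hk₁
  -- the threshold `s₀` on the ray: `e^{κ s₀} · max H = T₀`
  set s₀ : ℝ := Real.log (T₀ / H k₁) / κ with hs₀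
  have hexp_s₀ : Real.exp (κ * s₀) = T₀ / H k₁ := by
    rw [hs₀, mul_div_cancel₀ _ hκ.ne', Real.exp_log (div_pos hT₀ hM0)]
  -- the compact block `B = ρ([0,1]) · 𝔎` and its left translates `A n = ρ(s₀ + n) · B`
  set B : Set G := ρ '' Set.Icc 0 1 * 𝔎 with hB
  have hBc : IsCompact B := (isCompact_Icc.image hρc).mul h𝔎
  have hBμ : μ B < ∞ := hBc.measure_lt_top
  set A : ℕ → Set G := fun n => (fun x => ρ (s₀ + n) * x) '' B with hA
  have hAmeas : ∀ n, MeasurableSet (A n) := fun n =>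
    (hBc.image (continuous_const_mul (ρ (s₀ + n)))).isClosed.measurableSet
  have hAμ : ∀ n, μ (A n) = μ B := fun n => by
    show μ ((fun x => ρ (s₀ + n) * x) '' B) = μ B
    rw [Set.image_mul_left, measure_preimage_mul]
  -- the shells cover `S ∩ {T₀ < H}`
  have hcover : S ∩ {g | T₀ < H g} ⊆ ⋃ n, A n := by
    rintro g ⟨hgS, hgT⟩
    obtain ⟨x, ⟨s, rfl⟩, k, hk, rfl⟩ := Set.mem_mul.1 (hS hgS)
    have hgT' : T₀ < H (ρ s * k) := hgT
    have hs : s₀ < s := by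
      by_contra hle
      push Not at hle
      have hle' : H (ρ s * k) ≤ T₀ := by
        rw [hH]
        calc Real.exp (κ * s) * H k ≤ Real.exp (κ * s₀) * H k₁ :=
              mul_le_mul (Real.exp_le_exp.2 (mul_le_mul_of_nonneg_left hle hκ.le)) (hmax k hk)
                (hHpos k hk).le (Real.exp_pos _).le
          _ = T₀ := by rw [hexp_s₀, div_mul_cancel₀ _ hM0.ne']
      exact absurd hgT' (not_lt.2 hle')
    set n : ℕ := ⌊s - s₀⌋₊ with hn
    have hn1 : (n : ℝ) ≤ s - s₀ := Nat.floor_le (by linarith)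
    have hn2 : s - s₀ < n + 1 := Nat.lt_floor_add_one _
    refine Set.mem_iUnion.2 ⟨n, ⟨ρ (s - s₀ - n) * k, ?_, ?_⟩⟩
    · exact Set.mem_mul.2 ⟨ρ (s - s₀ - n), ⟨s - s₀ - n, ⟨by linarith, by linarith⟩, rfl⟩, k, hk, rfl⟩
    · show ρ (s₀ + n) * (ρ (s - s₀ - n) * k) = ρ s * k
      rw [← mul_assoc, ← hρ]
      congr 2
      ring
  -- the geometric bound on the `n`-th shell
  set r : ℝ := Real.exp (-(α * κ)) with hr
  have hr1 : r < 1 := Real.exp_lt_one_iff.2 (by nlinarith)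
  have hr0 : 0 ≤ r := (Real.exp_pos _).le
  set C₀ : ℝ := (H k₀ * Real.exp (κ * s₀)) ^ (-α) with hC₀
  have hC₀0 : 0 ≤ C₀ := Real.rpow_nonneg (by positivity) _
  have hshell : ∀ n : ℕ, ∀ g ∈ A n, ENNReal.ofReal (H g ^ (-α)) ≤ ENNReal.ofReal (C₀ * r ^ n) := by
    intro n g hg
    obtain ⟨x, hx, rfl⟩ := hg
    obtain ⟨y, ⟨u, hu, rfl⟩, k, hk, rfl⟩ := Set.mem_mul.1 hx
    have hHg : H (ρ (s₀ + n) * (ρ u * k)) = Real.exp (κ * (s₀ + n)) * (Real.exp (κ * u) * H k) := by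
      rw [hH, hH]
    have hy0 : 0 < H k₀ * Real.exp (κ * s₀) * Real.exp (κ * n) := by positivity
    have hy : H k₀ * Real.exp (κ * s₀) * Real.exp (κ * n) ≤ H (ρ (s₀ + n) * (ρ u * k)) := by
      rw [hHg, mul_add, Real.exp_add]
      have h1 : 1 ≤ Real.exp (κ * u) := Real.one_le_exp (mul_nonneg hκ.le hu.1)
      have h2 : H k₀ ≤ H k := hmin k hk
      have h3 : 0 ≤ Real.exp (κ * s₀) * Real.exp (κ * n) := by positivity
      calc H k₀ * Real.exp (κ * s₀) * Real.exp (κ * ↑n)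
          = Real.exp (κ * s₀) * Real.exp (κ * ↑n) * (1 * H k₀) := by ring
        _ ≤ Real.exp (κ * s₀) * Real.exp (κ * ↑n) * (Real.exp (κ * u) * H k) :=
          mul_le_mul_of_nonneg_left (mul_le_mul h1 h2 hm0.le (Real.exp_pos _).le) h3
    refine ENNReal.ofReal_le_ofReal ?_
    calc H (ρ (s₀ + n) * (ρ u * k)) ^ (-α) ≤ (H k₀ * Real.exp (κ * s₀) * Real.exp (κ * n)) ^ (-α) :=
          Real.rpow_le_rpow_of_nonpos hy0 hy (by linarith)
      _ = C₀ * r ^ n := by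
          rw [hC₀, hr, Real.mul_rpow (by positivity) (Real.exp_pos _).le, ← Real.exp_mul, ← Real.exp_nat_mul]
          congr 2
          ring
  -- sum up
  calc ∫⁻ g in S ∩ {g | T₀ < H g}, ENNReal.ofReal (H g ^ (-α)) ∂μ
      ≤ ∫⁻ g in ⋃ n, A n, ENNReal.ofReal (H g ^ (-α)) ∂μ := lintegral_mono_set hcover
    _ ≤ ∑' n, ∫⁻ g in A n, ENNReal.ofReal (H g ^ (-α)) ∂μ := lintegral_iUnion_le _ _
    _ ≤ ∑' n : ℕ, ENNReal.ofReal (C₀ * r ^ n) * μ B := by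
        refine ENNReal.tsum_le_tsum fun n => ?_
        calc ∫⁻ g in A n, ENNReal.ofReal (H g ^ (-α)) ∂μ ≤ ∫⁻ g in A n, ENNReal.ofReal (C₀ * r ^ n) ∂μ :=
              setLIntegral_mono' (hAmeas n) (hshell n)
          _ = ENNReal.ofReal (C₀ * r ^ n) * μ B := by rw [setLIntegral_const, hAμ]
    _ = (∑' n : ℕ, ENNReal.ofReal C₀ * ENNReal.ofReal r ^ n) * μ B := by
        rw [ENNReal.tsum_mul_right]
        congr 1
        refine tsum_congr fun n => ?_
        rw [ENNReal.ofReal_mul hC₀0, ENNReal.ofReal_pow hr0]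
    _ < ∞ := by
        rw [ENNReal.tsum_mul_left, ENNReal.tsum_geometric]
        refine ENNReal.mul_lt_top (ENNReal.mul_lt_top ENNReal.ofReal_lt_top ?_) hBμ
        exact ENNReal.inv_lt_top.2 (tsub_pos_iff_lt.2 (ENNReal.ofReal_lt_one.2 hr1))

end Generic

/-! ## §2 The row: the adelic torus `T(𝔸_F) ≤ B(𝔸_F)` of `U(J_N)` and the Borel height -/

namespace UnitaryGroup

open NumberField

variable {F E : Type} [Field F] [NumberField F] [Field E] [NumberField E] [Algebra F E]
  {c : E ≃ₐ[F] E} {N : ℕ} [NeZero N]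
  [MeasurableSpace (quasiSplit F E c N).Adelic] [BorelSpace (quasiSplit F E c N).Adelic]

omit [MeasurableSpace (quasiSplit F E c N).Adelic] [BorelSpace (quasiSplit F E c N).Adelic] in
/-- The Borel height is positive. [cite: Garrett2018, §2.2 (PDF p. 83)] -/
theorem borelHeight_pos (g : (quasiSplit F E c N).Adelic) : 0 < borelHeight g := by
  rw [borelHeight_def]
  exact inv_pos.2 (vecHeight_lastRow_pos g)

/-- **H10b — THE RAY INTEGRAL OF THE CUSP ESTIMATE (real cut-off).**  Let `μT` be a left-invariant measure, finite on
compacts, on the adelic torus `T(𝔸_F) ≤ B(𝔸_F)` of `U(J_N)` (`torusInBorel`; e.g. a Haar measure), `𝔎 ⊆ T(𝔸_F)` compact,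
`ρ : ℝ → T(𝔸_F)` a continuous ray (`ρ(a+b) = ρ(a) ρ(b)`) along which the Borel height is homogeneous,
`H(ρ(s) t) = e^{κ s} H(t)`, `κ > 0` (the diagonal ray `d(r_s, …, r_s⁻¹)`: ★ `borelHeight_torus_mul'`).  Then for every
torus Siegel set `S ⊆ ρ(ℝ) · 𝔎` and all `T₀ > 0`, `α > 0`:
`∫⁻_{S ∩ {T₀ < H}} H(t)^{-α} dμT < ∞`. [cite: Arthur1978TraceFormulaI, §8 (pp. 947–950)] [cite: Godement1964, §5] -/
theorem setLIntegral_rpow_neg_borelHeight_lt_top_real (μT : Measure (torusInBorel F E c N))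
    [μT.IsMulLeftInvariant] [IsFiniteMeasureOnCompacts μT] {𝔎 : Set (torusInBorel F E c N)} (h𝔎 : IsCompact 𝔎)
    {ρ : ℝ → torusInBorel F E c N} (hρc : Continuous ρ) (hρ : ∀ a b, ρ (a + b) = ρ a * ρ b) {κ : ℝ} (hκ : 0 < κ)
    (hH : ∀ (s : ℝ) (t : torusInBorel F E c N),
      (borelHeight (((ρ s * t : torusInBorel F E c N) : borelAdelic F E c N) : (quasiSplit F E c N).Adelic) : ℝ) =
        Real.exp (κ * s) * borelHeight (((t : torusInBorel F E c N) : borelAdelic F E c N) : (quasiSplit F E c N).Adelic))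
    {S : Set (torusInBorel F E c N)} (hS : S ⊆ Set.range ρ * 𝔎) {T₀ : ℝ} (hT₀ : 0 < T₀) {α : ℝ} (hα : 0 < α) :
    ∫⁻ t in S ∩ {t | T₀ < (borelHeight (((t : torusInBorel F E c N) : borelAdelic F E c N) :
        (quasiSplit F E c N).Adelic) : ℝ)},
      ENNReal.ofReal ((borelHeight (((t : torusInBorel F E c N) : borelAdelic F E c N) :
        (quasiSplit F E c N).Adelic) : ℝ) ^ (-α)) ∂μT < ∞ := by
  haveI : T2Space (borelAdelic F E c N) := t2Space_borelAdelic
  have hcont : Continuous fun t : torusInBorel F E c N =>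
      (borelHeight (((t : torusInBorel F E c N) : borelAdelic F E c N) : (quasiSplit F E c N).Adelic) : ℝ) :=
    NNReal.continuous_coe.comp
      (continuous_borelHeight.comp (continuous_subtype_val.comp continuous_subtype_val))
  exact setLIntegral_rpow_neg_lt_top_of_subset_range_mul μT h𝔎 hρc hρ hcont
    (fun k _ => NNReal.coe_pos.2 (borelHeight_pos _)) hκ hH hS hT₀ hα

/-- **H10b — THE RAY INTEGRAL OF THE CUSP ESTIMATE**, cut-off in `ℝ≥0` as in ★ H8b
`truncatedKernelIntegrable_of_majorant_maximalCompact` (`T₀ < borelHeight t`): under the same hypotheses,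
`∫⁻ t in S ∩ {t | T₀ < borelHeight ↑t}, ENNReal.ofReal ((borelHeight ↑t : ℝ) ^ (-α)) ∂μT < ∞`.
[cite: Arthur1978TraceFormulaI, §8 (pp. 947–950)] [cite: Godement1964, §5] -/
theorem setLIntegral_rpow_neg_borelHeight_lt_top (μT : Measure (torusInBorel F E c N))
    [μT.IsMulLeftInvariant] [IsFiniteMeasureOnCompacts μT] {𝔎 : Set (torusInBorel F E c N)} (h𝔎 : IsCompact 𝔎)
    {ρ : ℝ → torusInBorel F E c N} (hρc : Continuous ρ) (hρ : ∀ a b, ρ (a + b) = ρ a * ρ b) {κ : ℝ} (hκ : 0 < κ)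
    (hH : ∀ (s : ℝ) (t : torusInBorel F E c N),
      (borelHeight (((ρ s * t : torusInBorel F E c N) : borelAdelic F E c N) : (quasiSplit F E c N).Adelic) : ℝ) =
        Real.exp (κ * s) * borelHeight (((t : torusInBorel F E c N) : borelAdelic F E c N) : (quasiSplit F E c N).Adelic))
    {S : Set (torusInBorel F E c N)} (hS : S ⊆ Set.range ρ * 𝔎) {T₀ : ℝ≥0} (hT₀ : 0 < T₀) {α : ℝ} (hα : 0 < α) :
    ∫⁻ t in S ∩ {t | T₀ < borelHeight (((t : torusInBorel F E c N) : borelAdelic F E c N) :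
        (quasiSplit F E c N).Adelic)},
      ENNReal.ofReal ((borelHeight (((t : torusInBorel F E c N) : borelAdelic F E c N) :
        (quasiSplit F E c N).Adelic) : ℝ) ^ (-α)) ∂μT < ∞ := by
  have hset : {t : torusInBorel F E c N | T₀ < borelHeight (((t : torusInBorel F E c N) : borelAdelic F E c N) :
        (quasiSplit F E c N).Adelic)} =
      {t | (T₀ : ℝ) < (borelHeight (((t : torusInBorel F E c N) : borelAdelic F E c N) :
        (quasiSplit F E c N).Adelic) : ℝ)} := by
    ext t
    simp only [Set.mem_setOf_eq, NNReal.coe_lt_coe]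
  rw [hset]
  exact setLIntegral_rpow_neg_borelHeight_lt_top_real μT h𝔎 hρc hρ hκ hH hS (NNReal.coe_pos.2 hT₀) hα

end UnitaryGroup

end Literature.NumberTheory.Automorphic

end
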